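import Summits.QuantumFields.YangMills.Theses.ThermalDescent

/-!
# ThermalDescent — `SpectralBounds` (child of the PeriodDescent split, item stmt-QuantumFields-27309)

For `β ≥ 0`, `2 ≤ T ≤ T'` and spatial side `S ≥ 1`: `0 < λ₀(S)`, `λ₀^T' ≤ Z(S³×T')` and `Z(S³×2T) ≤ λ₀^T · Z(S³×T)`,
where `λ₀ = transferSpectralRadius` and `Z = wilsonFinTorusPartition`.  All three are read off the tree's trace formula
`exists_spectralData_wilsonFinTorusPartition` (`Z(S³×(m+2)) = Σᵢ λᵢ^(m+2)`, `0 ≤ λᵢ ≤ λ₀ = λ_{i₀}`, `0 < λ₀`), exactly as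
`Literature/…/Balaban1983to89/InfiniteVolumeSufficientXII.lean` proves `pow_transferSpectralRadius_le_cyclicPartition` and
`cyclicPartition_le_pow_mul`; the third clause is the termwise bound `λᵢ^(2m+4) ≤ λ₀^(m+2)·λᵢ^(m+2)`.
-/

namespace Summit.QuantumFields.YangMills.Theorems

open Literature.MathematicalPhysics.QuantumFieldTheory

open Summit.QuantumFields.YangMills.Theses.ThermalDescent in -- route file rev 5 (commit 2170c9be1a4e)
/-- Item `SpectralBounds` of route `ThermalDescent` (top-eigenvalue bounds from the trace formula). -/
theorem thermalDescent_spectralBounds :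
    Summit.QuantumFields.YangMills.Theses.ThermalDescent.SpectralBounds := by
  intro G _ _ _ _ hG r β S _ T T' hβ hT hTT'
  letI : MeasurableSpace G := borel G
  haveI : BorelSpace G := ⟨rfl⟩
  haveI : SecondCountableTopology G :=
    (r.continuous.isClosedEmbedding r.injective).isEmbedding.secondCountableTopology
  obtain ⟨s, _, b, lam, i₀, -, hord, hpos0, -, -, hrad, hZ⟩ :=
    exists_spectralData_wilsonFinTorusPartition (ρ := r.ρ) r.continuous r.mem_unitary hβ S
  refine ⟨by rw [hrad]; exact hpos0, ?_, ?_⟩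
  · obtain ⟨m, rfl⟩ : ∃ m, T' = m + 2 := ⟨T' - 2, by omega⟩
    rw [hrad]
    exact le_hasSum (hZ m) i₀ fun j _ => pow_nonneg (hord j).1 _
  · obtain ⟨m, rfl⟩ : ∃ m, T = m + 2 := ⟨T - 2, by omega⟩
    have h2 : 2 * (m + 2) = (2 * m + 2) + 2 := by ring
    rw [h2, hrad]
    refine hasSum_le (fun i => ?_) (hZ (2 * m + 2)) ((hZ m).mul_left (lam i₀ ^ (m + 2)))
    have hsplit : lam i ^ (2 * m + 2 + 2) = lam i ^ (m + 2) * lam i ^ (m + 2) := by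
      rw [← pow_add]; congr 1; ring
    rw [hsplit]
    exact mul_le_mul_of_nonneg_right (pow_le_pow_left₀ (hord i).1 (hord i).2 _) (pow_nonneg (hord i).1 _)

end Summit.QuantumFields.YangMills.Theorems
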